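import Summits.Schanuel.Schanuel.Theorems.DiophantineDichotomyApproximationPropertyCycleAPThreePrimeOfCurve
import Summits.Schanuel.Schanuel.Theorems.DiophantineDichotomyApproximationPropertySmallPrimeCurveThree
import Summits.Schanuel.Schanuel.Theorems.DiophantineDichotomyApproximationPropertySmallPrimeHypersurface
import Summits.Schanuel.Schanuel.Theorems.DiophantineDichotomyApproximationPropertyCurveHilbertLB
import HarnessLib

/-!
# Philippon's clause-free approximation property AP1 (`d' = 0`) in `ℙ³` with prime output: `CycleAP3Prime` (crux `ApproximationProperty`)

Crux `stmt-Schanuel-6117` (`Summit.Schanuel.Schanuel.Theses.DiophantineDichotomy.ApproximationProperty`),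
line `orbit-interpolation-determinant` (lead `prover-line-stmt-Schanuel-6117-c3-0`), registered sub-goals
`CycleAP3Prime` and `cycleAP3Prime_of`: for every `ω ∈ ℂ³` there is `c = c(ω) ≥ 1` such that for all
`Y ≥ Δ ≥ c` some homogeneous PRIME ideal `𝔭 ⊂ ℚ[x₀, …, x₃]` of rank `1` (a Galois orbit of points of `ℙ³`)
has

  `deg 𝔭 ≤ (cΔ)³`, `h(𝔭) ≤ c Y Δ²`, `log |𝔭(1 : ω)| ≤ −(Δ · h(𝔭) + Y · deg 𝔭) / c`.

This is the approximation property AP1 of Philippon with `d' = 0`, `n = 3` — the printed frontier of the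
subject (Laurent–Roy–Philippon; Nesterenko–Philippon (eds.), LNM 1752, Ch. 4 §4 p. 61: AP1 is proved for
`d' ∈ {n − 3, …, n}`; Philippon, J. Number Theory 81 (2000) for the construction), re-derived here from the
tree's proved elimination theory (LNM 1752 Ch. 3: Prop. 4.7, 4.8, 4.11, 4.13) by a THREE-CUT DESCENT at
`ω̄ = (1 : ω)`:

1. `small_prime_hypersurface` (p118758): Dirichlet's box principle for quaternary forms + Prop. 4.8 +
   weighted pigeonhole ⟹ a small prime SURFACE `(Q₁)`, `deg ≤ Δ`, `h ≤ 19 Y`,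
   `log |(Q₁)(ω̄)| ≤ −(Δ²/c₁)(Δ(h + a₁) + Y a₁)`;
2. `smallPrimeCurve3_of` (p120742): box principle modulo `(Q₁)` in degree `2⌊Δ⌋` with the ADAPTIVE height
   `h₂ = 16 (Y + Δ h((Q₁))/a₁)`, Prop. 4.11 cut + Prop. 4.7 pigeonhole (`small_prime_of_cut`, p114984) ⟹ a small
   prime CURVE `𝔭₂ ⊇ (Q₁, P₂)`, `deg ≤ 2Δ²`, `h ≤ c₂ Δ Y`, small at RATE `Δ/c₂`;
3. `cycleAP3Prime_of_curve` (p120784): box principle modulo `𝔭₂` in degree `a₁ + b₂ + ⌊Δ⌋` over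
   `⌊Δ⌋ · deg 𝔭₂` standard monomials — supplied by the curve Hilbert-function lower bound
   `curveHilbert_lowerBound` (p120855 ← p119455, p119238: `H(𝔭₂; ν) ≥ (ν − a₁ − b₂) deg 𝔭₂`, generic
   rational section + Bézout identity for the Chow form + telescoping) — again with an adaptive height,
   then `small_prime_of_cut` (rank `2 → 1`) and the share bookkeeping ⟹ the 0-dimensional prime `𝔭`.

What is NOT here: the INTERPOLATION CLAUSE of `CycleAPIAt 3` (zeros of `𝔭` imposing independent conditions
on forms of degree `⌊cΔ⌋`), which the plain descent cannot guarantee (lead c2 / siege analyses: orbits on a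
multiple component of the curve section). `CycleAP3Prime` is the input of every post-processing of such
"bad" orbits toward the registered `t = 3` targets `PointAPAt3 : PointAPAbsAt 3` / `CycleAPIAt3 : CycleAPIAt 3`.

Everything is PROVED; no definitions, no named facts.
-/

set_option linter.dupNamespace false

noncomputable section

namespace Summit.Schanuel.Schanuel.Cruxes.ApproximationProperty.OrbitInterpolationDeterminant

open Literature.NumberTheory.Transcendental Literature.NumberTheory.Transcendental.Nesterenko
open MvPolynomial Real Module

attribute [local instance] MvPolynomial.gradedAlgebra

/-- **Registered sub-goal `cycleAP3Prime_of`** (crux stmt-Schanuel-6117): the clause-free `t = 3` descent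
as an implication — (statement of `small_prime_hypersurface`) → (statement of `curveHilbert_lowerBound`) →
(statement of `CycleAP3Prime`); composition BY NAME of `smallPrimeCurve3_of` (cuts 1–2) and
`cycleAP3Prime_of_curve` (cut 3). [cite: NesterenkoPhilippon2001, Ch. 4 §4 (p. 61), AP1 with d' = 0, n = 3] -/
theorem cycleAP3Prime_of : (∀ (m : ℕ) (ω : Fin m → ℂ), 1 ≤ m → ∃ c : ℝ, 1 ≤ c ∧ ∀ Δ Y : ℝ, c ≤ Δ → Δ ≤ Y → ∃ (Q : Rx m) (a : ℕ), Q ≠ 0 ∧ Q.IsHomogeneous a ∧ 1 ≤ a ∧ (a : ℝ) ≤ Δ ∧ (Ideal.span {Q}).IsPrime ∧ ideg (Ideal.span {Q}) m = a ∧ iheight (Ideal.span {Q}) m ≤ (2 * (m : ℝ) ^ 2 + 1) * Y ∧ iabs (Ideal.span {Q}) m (Fin.cons 1 ω) ≤ Real.exp (-(Δ ^ (m - 1) / c * (Δ * (iheight (Ideal.span {Q}) m + a) + Y * a)))) → (∀ (Q P : Rx 3) (a b : ℕ), Q ≠ 0 → Q.IsHomogeneous a → P.IsHomogeneous b → 1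 ≤ a → 1 ≤ b → (Ideal.span {Q}).IsPrime → P ∉ Ideal.span {Q} → ∀ 𝔭 : Ideal (Rx 3), 𝔭.IsPrime → (letI := MvPolynomial.gradedAlgebra (σ := Fin (3 + 1)) (R := ℚ); 𝔭.IsHomogeneous (MvPolynomial.homogeneousSubmodule (Fin (3 + 1)) ℚ)) → Q ∈ 𝔭 → P ∈ 𝔭 → ringKrullDim (Rx 3 ⧸ 𝔭) = (2 : ℕ) → ∀ ν : ℕ, a + b ≤ ν → (ν - a - b) * Literature.NumberTheory.Transcendental.Nesterenko.ideg 𝔭 2 + Module.finrank ℚ ↥(Literature.RingTheory.MvPolynomial.idealDegree 𝔭 ν) ≤ Module.finrank ℚ ↥(MvPolynomial.homogeneousSubmodule (Fin (3 + 1)) ℚ ν)) → ∀ ω : Fin 3 → ℂ, ∃ c : ℝ, 1 ≤ c ∧ ∀ Δ Y : ℝ, c ≤ Δ → Δ ≤ Y → ∃ 𝔭 : Ideal (Rx 3), 𝔭.IsPrime ∧ 𝔭.IsHomogeneous (homogeneousSubmodule (Fin (3 + 1)) ℚ) ∧ IsUnmixedOfRank 𝔭 1 ∧ (ideg 𝔭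 1 : ℝ) ≤ (c * Δ) ^ 3 ∧ iheight 𝔭 1 ≤ c * Y * Δ ^ 2 ∧ iabs 𝔭 1 (Fin.cons 1 ω) ≤ Real.exp (-((Δ * iheight 𝔭 1 + Y * ideg 𝔭 1) / c)) :=
  fun h1 h2 => cycleAP3Prime_of_curve (smallPrimeCurve3_of h1) h2

/-- **Registered sub-goal `CycleAP3Prime` — Philippon's approximation property AP1 (`d' = 0`) in `ℙ³`,
clause-free, with PRIME output**: for every `ω ∈ ℂ³` there is `c ≥ 1` such that for all `Y ≥ Δ ≥ c` some
homogeneous prime `𝔭 ⊂ ℚ[x₀,…,x₃]` of rank `1` has `deg 𝔭 ≤ (cΔ)³`, `h(𝔭) ≤ cYΔ²` and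
`|𝔭(1:ω)| ≤ exp(−(Δ·h(𝔭) + Y·deg 𝔭)/c)`. Unconditional: `cycleAP3Prime_of` fed with the landed
`small_prime_hypersurface` and `curveHilbert_lowerBound`.
[cite: NesterenkoPhilippon2001, Ch. 4 §4 (p. 61), AP1 with d' = 0, n = 3] -/
theorem CycleAP3Prime : ∀ ω : Fin 3 → ℂ, ∃ c : ℝ, 1 ≤ c ∧ ∀ Δ Y : ℝ, c ≤ Δ → Δ ≤ Y → ∃ 𝔭 : Ideal (Rx 3), 𝔭.IsPrime ∧ 𝔭.IsHomogeneous (homogeneousSubmodule (Fin (3 + 1)) ℚ) ∧ IsUnmixedOfRank 𝔭 1 ∧ (ideg 𝔭 1 : ℝ) ≤ (c * Δ) ^ 3 ∧ iheight 𝔭 1 ≤ c * Y * Δ ^ 2 ∧ iabs 𝔭 1 (Fin.cons 1 ω) ≤ Real.exp (-((Δ * iheight 𝔭 1 + Y * ideg 𝔭 1) / c)) :=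
  cycleAP3Prime_of small_prime_hypersurface curveHilbert_lowerBound

end Summit.Schanuel.Schanuel.Cruxes.ApproximationProperty.OrbitInterpolationDeterminant

end
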